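import Literature.NumberTheory.LFunctions.SuzukiScrewLineThm42RProofs
import Literature.NumberTheory.LFunctions.SuzukiScrewLineRepairedEq48
import HarnessLib

/-!
# CJM Thm 4.4 (repaired): `‖P̂ᴿ_φ‖² = π⟨φ,φ⟩_{G_g}` for all test `φ` under RH — discharge of `Suzuki2025_thm44R`

LINE 1 — LABEL: RH-CONSEQUENCE proof (explicit binder `RiemannHypothesis →`, never dropped) of clause
(ii) of the printed criterion CJM Thm 4.4 over the REPAIRED screw line of the cell (erratum E21,
`SuzukiScrewLineRepaired.lean`), whence the RH-EQUIVALENT·PRINTED-REPAIRED record `Suzuki2025_thm44R`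
is PROVED (its equivalence (i) AS AN EQUIVALENCE — the cell's `Suzuki2025_thm44R_mpr` /
`Suzuki2025_thm44R_of_onlyIf`). bears_on: B-C/B-P (LADDER-RH COLUMN 6 DBR). WHAT THIS IS NOT: (4.7)ᴿ
itself is shown by nobody; discharging the record fixes WHICH identity (`‖P̂ᴿ_φ‖² = π⟨φ,φ⟩_{G_g}` on
mean-zero `C_c^∞`) would prove RH through this door; it does not move RH; nothing here bears on the
truth of RH.

Source: M. Suzuki, *On the Hilbert space derived from the Weil distribution*, Canad. J. Math. 2025 =
arXiv:2301.00421v3 [Suzuki2025WeilHilbertSpace], Thm 4.4 (TeX l.1274–1284) and §4.3.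

## Proof route

CJM proves (4.8) `‖P̂_φ‖² = π Σ_γ m_γ|(φ̂(γ) − φ̂(0))/γ|²` "by (3.7) and Prop 4.1" and then
`= π⟨φ,φ⟩_{G_g}` "by (4.9) and (2.2)" (TeX l.1286–1300). Here the second half is obtained from the
screw-line identity (4.4)ᴿ `∫ 𝔖ᴿ_t conj 𝔖ᴿ_u = π G_g(t,u)` (CJM Thm 4.2 repaired, the tree theorem
`ScrewLineThm42.integral_screwLineR_mul_conj`) by Fubini:
`‖P̂ᴿ_φ‖² = ∫_x |∫_t 𝔖ᴿ_t♯(x)φ(t)dt|² dx = ∫∫ φ(t) conj φ(u) (∫_x 𝔖ᴿ_u conj 𝔖ᴿ_t dx) dt du = π⟨φ,φ⟩_{G_g}`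
— "the right-hand side of (4.4) multiplied by `φ(t) conj φ(u)` and integrated equals `π⟨φ,φ⟩_{G_g}`",
exactly as in the cell's even-extension twin `Suzuki2025_thm44_mp_of_thm42` (whose hypothesis was
unsatisfiable, E21); the triple integrand is dominated by `36K_R²(1+|x|)^{−3/2}|φ(t)||φ(u)|`
(Prop 1.2ᴿ/1.3ᴿ bounds `norm_screwLineR_le_log_unif`). As a COROLLARY (with (4.8)ᴿ =
`Suzuki2025_eq48R` of the cell) the hermitian-form expansion "(4.9) applied to (2.2)" under RH,
`⟨φ,φ⟩_{G_g} = Σ_γ m_γ|φ̂(γ) − φ̂(0)|²/|γ|²`, drops out (`zetaScrewForm_eq_tsum_of_RH`), which is the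
input of the cell's door `Suzuki2025_thm44R_of_form_expansion`. No definition, no named fact.

## Main results
* `ScrewLineThm44.measurable_screwLineR_uncurry` — joint measurability of `(x,t) ↦ 𝔖ᴿ_t(x)` (RH-FREE).
* `Suzuki2025_thm44R_onlyIf` — clause (ii): `RH ⟹ ‖P̂ᴿ_φ‖² = π⟨φ,φ⟩_{G_g}` for every test `φ`.
* `Suzuki2025_thm44R_holds : Suzuki2025_thm44R`.
* `zetaScrewForm_eq_tsum_of_RH` — `RH ⟹ ⟨φ,φ⟩_{G_g} = Σ_ρ m_ρ‖φ̂(γ_ρ) − φ̂(0)‖²/‖γ_ρ‖²`.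
* `Suzuki2025_thm45R` — CJM Thm 4.5 over the repaired objects, `RH ⟺ ‖ψ‖₀ᴿ² = ⟨ψ,ψ⟩_W` on
  `C_c^∞(ℝ)` (= (1.9)ᴿ ÷ π, from the cell's `Suzuki2025_thm14R_holds`), PROVED AS AN EQUIVALENCE.

## References
* [Suzuki2025WeilHilbertSpace] M. Suzuki, Canad. J. Math. 2025 = arXiv:2301.00421v3, Thm 4.4
  (TeX l.1274–1284), its proof (l.1286–1300, l.1396–1412), (4.4) (l.1182–1194), (2.2) (l.550–553).
-/

noncomputable section

open MeasureTheory Complex Filter Set Real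
open Literature.Analysis.DeBrangesSpaces (sharp sharp_apply sharp_ofReal)
open scoped ComplexConjugate Topology ENNReal

namespace Literature.NumberTheory.LFunctions

open ZetaZeros ScrewLineL2 ScrewLineThm42

namespace ScrewLineThm44

/-- `|z|² = z·z̄` as a cast identity. [folklore] -/
private theorem ofReal_norm_sq_eq_mul_conj (z : ℂ) : ((‖z‖ ^ 2 : ℝ) : ℂ) = z * conj z := by
  rw [Complex.mul_conj, Complex.normSq_eq_norm_sq, Complex.ofReal_pow]

/-- **Joint measurability of `(x, t) ↦ 𝔖ᴿ_t(x)` on `ℝ × ℝ`** (RH-FREE): on `t ≥ 0` it is `𝔖_t(x)`, on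
`t < 0` it is `Θ♯(x)𝔖_{−t}(−x)` off the zeros of `Θ♯` and `𝔖_{−t}(−x)` on them
(`screwLineR_of_neg`, `screwLineR_of_neg_of_eq_zero`), all jointly measurable pieces.
[cite: Suzuki2025WeilHilbertSpace, Prop. 1.3 (TeX l.392–405); erratum E21] -/
theorem measurable_screwLineR_uncurry : Measurable fun p : ℝ × ℝ ↦ screwLineR p.2 (p.1 : ℂ) := by
  -- the pieces
  have m0 : Measurable fun p : ℝ × ℝ ↦ screwLine p.2 (p.1 : ℂ) := measurable_screwLine_uncurry'
  have hneg : Measurable fun p : ℝ × ℝ ↦ ((-p.1 : ℝ), (-p.2 : ℝ)) :=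
    Measurable.prodMk (measurable_neg.comp measurable_fst) (measurable_neg.comp measurable_snd)
  have m1 : Measurable fun p : ℝ × ℝ ↦ screwLine (-p.2) ((-p.1 : ℝ) : ℂ) := by
    have h := measurable_screwLine_uncurry'.comp hneg
    simpa only [Function.comp_def] using h
  have m1' : Measurable fun p : ℝ × ℝ ↦ screwLine (-p.2) (-(p.1 : ℂ)) := by
    simpa only [Complex.ofReal_neg] using m1
  have mθ : Measurable fun p : ℝ × ℝ ↦ sharp lagariasTheta (p.1 : ℂ) := by
    have : (fun p : ℝ × ℝ ↦ sharp lagariasTheta (p.1 : ℂ)) =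
        fun p ↦ (starRingEnd ℂ) (lagariasTheta (p.1 : ℂ)) := funext fun p ↦ sharp_ofReal _ _
    rw [this]
    exact Complex.continuous_conj.measurable.comp
      (measurable_lagariasTheta.comp (Complex.measurable_ofReal.comp measurable_fst))
  have hS : MeasurableSet {p : ℝ × ℝ | sharp lagariasTheta (p.1 : ℂ) = 0} :=
    mθ (measurableSet_singleton 0)
  have hT : MeasurableSet {p : ℝ × ℝ | 0 ≤ p.2} := measurableSet_le measurable_const measurable_snd
  -- the piecewise description
  have heq : (fun p : ℝ × ℝ ↦ screwLineR p.2 (p.1 : ℂ)) = fun p ↦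
      if 0 ≤ p.2 then screwLine p.2 (p.1 : ℂ)
      else if sharp lagariasTheta (p.1 : ℂ) = 0 then screwLine (-p.2) (-(p.1 : ℂ))
        else sharp lagariasTheta (p.1 : ℂ) * screwLine (-p.2) (-(p.1 : ℂ)) := by
    funext p
    split_ifs with h h'
    · rw [screwLineR_of_nonneg h]
    · exact screwLineR_of_neg_of_eq_zero (not_le.1 h) h'
    · exact screwLineR_of_neg (not_le.1 h) h'
  rw [heq]
  exact Measurable.ite hT m0 (Measurable.ite hS m1' (mθ.mul m1'))

end ScrewLineThm44

open ScrewLineThm44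

/-- **CJM Thm 4.4 clause (ii), repaired: under RH, `‖P̂ᴿ_φ‖²_{L²(ℝ)} = π⟨φ,φ⟩_{G_g}` for every
`φ ∈ C_c^∞(ℝ)`** — from the screw-line identity (4.4)ᴿ (`ScrewLineThm42.integral_screwLineR_mul_conj`,
CJM Thm 4.2) by Fubini: "the right-hand side [of (4.4)] multiplied by `φ(t) conj φ(u)` and integrated
equals `π⟨φ,φ⟩_{G_g}`" (TeX l.1400–1410); the triple integrand is dominated by
`36K_R²(1+|x|)^{−3/2}|φ(t)||φ(u)|` (`norm_screwLineR_le_log_unif`). RH-CONSEQUENCE (explicit binder).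
[cite: Suzuki2025WeilHilbertSpace, Thm. 4.4 (ii) (TeX l.1274–1284), proof (l.1286–1300, l.1396–1412); erratum E21] -/
theorem Suzuki2025_thm44R_onlyIf (hRH : RiemannHypothesis) {φ : ℝ → ℂ} (hφ : IsWeilTest φ) :
    ((∫ x : ℝ, ‖screwPhatR φ x‖ ^ 2 : ℝ) : ℂ) = Real.pi * zetaScrewForm univ φ φ := by
  obtain ⟨R, -, hR⟩ := hφ.2.exists_pos_le_norm
  obtain ⟨K, hK0, hK⟩ := norm_screwLineR_le_log_unif R
  have hφc : Continuous φ := hφ.1.continuous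
  have hφn : Integrable (fun t : ℝ ↦ ‖φ t‖) := (hφc.integrable_of_hasCompactSupport hφ.2).norm
  have hφR : ∀ t : ℝ, R < |t| → φ t = 0 := fun t ht ↦ hR t (by rw [Real.norm_eq_abs]; exact ht.le)
  -- pointwise decay `‖𝔖ᴿ_t(x)‖ ≤ 6K(1+|x|)^{-3/4}` for `|t| ≤ R`
  have hdec : ∀ t x : ℝ, |t| ≤ R → ‖screwLineR t x‖ ≤ 6 * K * (1 + |x|) ^ (-(3 / 4 : ℝ)) := by
    intro t x ht
    refine (hK t x ht).trans ?_
    have := one_add_log_div_le' x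
    calc K * ((1 + Real.log (2 + |x|)) / (1 + |x|)) ≤ K * (6 * (1 + |x|) ^ (-(3 / 4 : ℝ))) := by
          gcongr
      _ = 6 * K * (1 + |x|) ^ (-(3 / 4 : ℝ)) := by ring
  -- the triple integrand
  set F : ℝ → ℝ × ℝ → ℂ := fun x p ↦
    ((starRingEnd ℂ) (screwLineR p.1 (x : ℂ)) * φ p.1) * (screwLineR p.2 (x : ℂ) * (starRingEnd ℂ) (φ p.2))
    with hF
  -- Step 1: `|P̂ᴿ_φ(x)|² = ∫∫ F(x; t, u)`
  have hstep1 : ∀ x : ℝ, ((‖screwPhatR φ x‖ ^ 2 : ℝ) : ℂ) = ∫ p : ℝ × ℝ, F x p := by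
    intro x
    rw [ofReal_norm_sq_eq_mul_conj]
    have hP : screwPhatR φ x = ∫ t : ℝ, (starRingEnd ℂ) (screwLineR t (x : ℂ)) * φ t := by
      unfold screwPhatR
      exact integral_congr_ae (ae_of_all _ fun t ↦ by simp only [sharp_ofReal])
    have hPc : (starRingEnd ℂ) (screwPhatR φ x) =
        ∫ u : ℝ, screwLineR u (x : ℂ) * (starRingEnd ℂ) (φ u) := by
      rw [hP, ← integral_conj]
      exact integral_congr_ae (ae_of_all _ fun u ↦ by simp)
    rw [hPc, hP, ← integral_prod_mul]
    rfl
  -- Step 2: integrability of the triple integrand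
  have hmeasS : ∀ (g : ℝ × (ℝ × ℝ) → ℝ), Measurable g →
      Measurable fun q : ℝ × (ℝ × ℝ) ↦ screwLineR (g q) ((q.1 : ℝ) : ℂ) := by
    intro g hg
    have h := measurable_screwLineR_uncurry.comp (measurable_fst.prodMk hg)
    simpa only [Function.comp_def] using h
  have hFm : Measurable (Function.uncurry F) := by
    have m1 : Measurable fun q : ℝ × (ℝ × ℝ) ↦ screwLineR q.2.1 ((q.1 : ℝ) : ℂ) :=
      hmeasS (fun q ↦ q.2.1) (measurable_fst.comp measurable_snd)
    have m2 : Measurable fun q : ℝ × (ℝ × ℝ) ↦ screwLineR q.2.2 ((q.1 : ℝ) : ℂ) :=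
      hmeasS (fun q ↦ q.2.2) (measurable_snd.comp measurable_snd)
    have mφ1 : Measurable fun q : ℝ × (ℝ × ℝ) ↦ φ q.2.1 :=
      hφc.measurable.comp (measurable_fst.comp measurable_snd)
    have mφ2 : Measurable fun q : ℝ × (ℝ × ℝ) ↦ φ q.2.2 :=
      hφc.measurable.comp (measurable_snd.comp measurable_snd)
    exact ((Complex.continuous_conj.measurable.comp m1).mul mφ1).mul
      (m2.mul (Complex.continuous_conj.measurable.comp mφ2))
  have hxint : Integrable (fun x : ℝ ↦ (1 + |x|) ^ (-(3 / 2 : ℝ))) := by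
    have hint := integrable_one_add_norm (E := ℝ) (μ := volume) (r := 3 / 2)
      (by rw [Module.finrank_self]; norm_num)
    refine hint.congr (ae_of_all _ fun x ↦ ?_)
    simp only [Real.norm_eq_abs]
  have hB : Integrable (fun q : ℝ × (ℝ × ℝ) ↦
      ((6 * K) ^ 2 * (1 + |q.1|) ^ (-(3 / 2 : ℝ))) * (‖φ q.2.1‖ * ‖φ q.2.2‖)) :=
    (hxint.const_mul _).mul_prod (hφn.mul_prod hφn)
  have hFint : Integrable (Function.uncurry F) (volume.prod volume) := by
    refine hB.mono' hFm.aestronglyMeasurable (ae_of_all _ fun q ↦ ?_)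
    obtain ⟨x, t, u⟩ := q
    simp only [Function.uncurry_apply_pair, hF]
    rw [norm_mul, norm_mul, norm_mul, Complex.norm_conj, Complex.norm_conj]
    have hpow : 0 ≤ (1 + |x|) ^ (-(3 / 2 : ℝ)) := Real.rpow_nonneg (by positivity) _
    have hpow' : ((1 + |x|) ^ (-(3 / 4 : ℝ))) * ((1 + |x|) ^ (-(3 / 4 : ℝ))) =
        (1 + |x|) ^ (-(3 / 2 : ℝ)) := by
      rw [← Real.rpow_add (by positivity)]; norm_num
    by_cases ht : |t| ≤ R
    · by_cases hu : |u| ≤ R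
      · have h1 := hdec t x ht
        have h2 := hdec u x hu
        calc ‖screwLineR t x‖ * ‖φ t‖ * (‖screwLineR u x‖ * ‖φ u‖)
            = (‖screwLineR t x‖ * ‖screwLineR u x‖) * (‖φ t‖ * ‖φ u‖) := by ring
          _ ≤ (6 * K * (1 + |x|) ^ (-(3 / 4 : ℝ))) * (6 * K * (1 + |x|) ^ (-(3 / 4 : ℝ))) *
                (‖φ t‖ * ‖φ u‖) := by
              exact mul_le_mul_of_nonneg_right (mul_le_mul h1 h2 (norm_nonneg _) (by positivity))
                (by positivity)
          _ = (6 * K) ^ 2 * (1 + |x|) ^ (-(3 / 2 : ℝ)) * (‖φ t‖ * ‖φ u‖) := by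
              rw [← hpow']; ring
      · have : φ u = 0 := hφR u (lt_of_not_ge hu)
        simp only [this, norm_zero, mul_zero]
        all_goals positivity
    · have : φ t = 0 := hφR t (lt_of_not_ge ht)
      simp only [this, norm_zero, mul_zero, zero_mul]
      all_goals positivity
  -- Step 3: the inner `x`-integral, by (4.4)ᴿ
  have hinner : ∀ p : ℝ × ℝ, ∫ x : ℝ, F x p =
      φ p.1 * (starRingEnd ℂ) (φ p.2) * (Real.pi * (zetaScrewKernel p.2 p.1 : ℂ)) := by
    intro p
    rw [← integral_screwLineR_mul_conj hRH p.2 p.1, ← integral_const_mul]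
    refine integral_congr_ae (ae_of_all _ fun x ↦ ?_)
    simp only [hF]
    ring
  -- Step 4: the `(t,u)`-integrand is integrable (continuous, compact support)
  have hH : Integrable (fun p : ℝ × ℝ ↦
      (zetaScrewKernel p.1 p.2 : ℂ) * φ p.2 * (starRingEnd ℂ) (φ p.1)) := by
    have hKc : Continuous fun p : ℝ × ℝ ↦ (zetaScrewKernel p.1 p.2 : ℂ) := by
      refine Complex.continuous_ofReal.comp ?_
      unfold zetaScrewKernel
      exact ((continuous_zetaScrew.comp continuous_fst).add
        (continuous_zetaScrew.comp continuous_snd)).sub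
        (continuous_zetaScrew.comp (continuous_fst.sub continuous_snd))
    have hc : Continuous fun p : ℝ × ℝ ↦
        (zetaScrewKernel p.1 p.2 : ℂ) * φ p.2 * (starRingEnd ℂ) (φ p.1) :=
      (hKc.mul (hφc.comp continuous_snd)).mul
        (Complex.continuous_conj.comp (hφc.comp continuous_fst))
    refine hc.integrable_of_hasCompactSupport ?_
    refine HasCompactSupport.intro ((isCompact_closedBall (0 : ℝ) R).prod
      (isCompact_closedBall (0 : ℝ) R)) fun p hp ↦ ?_
    rw [Set.mem_prod, Metric.mem_closedBall, Metric.mem_closedBall, dist_zero_right,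
      dist_zero_right, Real.norm_eq_abs, Real.norm_eq_abs, not_and_or, not_le, not_le] at hp
    rcases hp with h1 | h2
    · rw [hφR p.1 h1, map_zero, mul_zero]
    · rw [hφR p.2 h2, mul_zero, zero_mul]
  -- assemble
  calc ((∫ x : ℝ, ‖screwPhatR φ x‖ ^ 2 : ℝ) : ℂ)
      = ∫ x : ℝ, ((‖screwPhatR φ x‖ ^ 2 : ℝ) : ℂ) := integral_ofReal.symm
    _ = ∫ x : ℝ, ∫ p : ℝ × ℝ, F x p := integral_congr_ae (ae_of_all _ hstep1)
    _ = ∫ p : ℝ × ℝ, ∫ x : ℝ, F x p := integral_integral_swap hFint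
    _ = ∫ p : ℝ × ℝ, φ p.1 * (starRingEnd ℂ) (φ p.2) * (Real.pi * (zetaScrewKernel p.2 p.1 : ℂ)) :=
        integral_congr_ae (ae_of_all _ hinner)
    _ = Real.pi * ∫ p : ℝ × ℝ, (zetaScrewKernel p.2 p.1 : ℂ) * φ p.1 * (starRingEnd ℂ) (φ p.2) := by
        rw [← integral_const_mul]
        exact integral_congr_ae (ae_of_all _ fun p ↦ by ring)
    _ = Real.pi * ∫ p : ℝ × ℝ, (zetaScrewKernel p.1 p.2 : ℂ) * φ p.2 * (starRingEnd ℂ) (φ p.1) := by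
        congr 1
        rw [Measure.volume_eq_prod]
        exact integral_prod_swap
          (fun q : ℝ × ℝ ↦ (zetaScrewKernel q.1 q.2 : ℂ) * φ q.2 * (starRingEnd ℂ) (φ q.1))
    _ = Real.pi * zetaScrewForm univ φ φ := by
        congr 1
        have hH' : Integrable (fun p : ℝ × ℝ ↦
            (zetaScrewKernel p.1 p.2 : ℂ) * φ p.2 * (starRingEnd ℂ) (φ p.1)) (volume.prod volume) := hH
        rw [Measure.volume_eq_prod, integral_prod _ hH']
        unfold zetaScrewForm
        simp only [Measure.restrict_univ]

/-- **Discharge of `Suzuki2025_thm44R` (CJM Thm 4.4 over the repaired screw line, erratum E21)**: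
(i) `RH ⟺` (4.7)ᴿ for all mean-zero test `φ` — PROVED AS AN EQUIVALENCE (`⇐` = Weil's criterion, the
cell's `Suzuki2025_thm44R_mpr`); (ii) `RH ⟹` (4.7)ᴿ for all test `φ` (`Suzuki2025_thm44R_onlyIf`).
RH-EQUIVALENT·PRINTED-REPAIRED record, PROVED (neither side of RH asserted).
[cite: Suzuki2025WeilHilbertSpace, Thm. 4.4 (TeX l.1274–1284); erratum E21] -/
theorem Suzuki2025_thm44R_holds : Suzuki2025_thm44R :=
  Suzuki2025_thm44R_of_onlyIf fun hRH _ hφ ↦ Suzuki2025_thm44R_onlyIf hRH hφ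

/-- **"(4.9) applied to (2.2)" under RH: `⟨φ,φ⟩_{G_g} = Σ_ρ m_ρ‖φ̂(γ_ρ) − φ̂(0)‖²/‖γ_ρ‖²` for every test
`φ`** (`φ̂ = suzukiHat φ`, `⟨φ,φ⟩_{G_g} = zetaScrewForm univ φ φ`) — the zero expansion of the hermitian
form of the screw function `g_ξ` for plain test weights, obtained by comparing (4.8)ᴿ
(`Suzuki2025_eq48R`, "by (3.7) and Prop 4.1") with clause (ii) above; this is the input of the cell's
door `Suzuki2025_thm44R_of_form_expansion`. RH-CONSEQUENCE (explicit binder).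
[cite: Suzuki2025WeilHilbertSpace, proof of Thm. 4.4 (TeX l.1297–1300, "by (4.9) and (2.2), noting the symmetry γ ↦ −γ")] -/
theorem zetaScrewForm_eq_tsum_of_RH (hRH : RiemannHypothesis) {φ : ℝ → ℂ} (hφ : IsWeilTest φ) :
    zetaScrewForm univ φ φ = ((∑' ρ : ZetaZeros.riemannZetaNontrivialZeros,
      (riemannZetaZeroOrder (ρ : ℂ) : ℝ) * ‖suzukiHat φ (suzukiZeroParam (ρ : ℂ)) - suzukiHat φ 0‖ ^ 2 /
        ‖suzukiZeroParam (ρ : ℂ)‖ ^ 2 : ℝ) : ℂ) := by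
  have h1 := Suzuki2025_thm44R_onlyIf hRH hφ
  rw [(Suzuki2025_eq48R hRH hφ).2] at h1
  have hπ : (Real.pi : ℂ) ≠ 0 := Complex.ofReal_ne_zero.2 Real.pi_ne_zero
  rw [Complex.ofReal_mul] at h1
  exact (mul_left_cancel₀ hπ h1).symm

/-! ## CJM Thm 4.5 over the repaired objects -/

/-- RH-EQUIVALENT (line 1)·PRINTED-REPAIRED (E21), PROVED AS AN EQUIVALENCE (neither side asserted):
**CJM Thm 4.5 over the repaired screw line** — the RH is true if and only if `‖ψ‖₀ᴿ² = ⟨ψ,ψ⟩_W` (4.11)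
for all `ψ ∈ C_c^∞(ℝ)`, where `‖ψ‖₀ᴿ = π^{−1/2}‖P̂ᴿ_{Dψ}‖_{L²}` (3.9)ᴿ (`screwNormZeroR`) and
`⟨ψ,ψ⟩_W = weilQuadratic ψ`. Printed derivation: "Using (3.9), Theorem 1.4 is stated as follows" — (1.9)
divided by `π`; here from the cell's tree theorem `Suzuki2025_thm14R_holds` (CJM Thm 1.4 repaired). The
cell's `Suzuki2025_thm45` is the same statement over the even-extension objects, conditional on the
record `Suzuki2025_thm14` (≡ `¬RH` as typed, E21); this is its repaired, unconditional form.
[cite: Suzuki2025WeilHilbertSpace, Thm. 4.5 (TeX l.1385–1393); erratum E21] -/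
theorem Suzuki2025_thm45R :
    RiemannHypothesis ↔ ∀ ψ : ℝ → ℂ, IsWeilTest ψ →
      ((screwNormZeroR ψ ^ 2 : ℝ) : ℂ) = weilQuadratic ψ := by
  have hπ : (Real.pi : ℂ) ≠ 0 := Complex.ofReal_ne_zero.mpr Real.pi_ne_zero
  have key : ∀ ψ : ℝ → ℂ, (((screwNormZeroR ψ ^ 2 : ℝ) : ℂ) = weilQuadratic ψ) ↔
      (((∫ x : ℝ, ‖screwPhatR (suzukiD ψ) x‖ ^ 2 : ℝ) : ℂ) = Real.pi * weilQuadratic ψ) := by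
    intro ψ
    have hA : 0 ≤ ∫ x : ℝ, ‖screwPhatR (suzukiD ψ) x‖ ^ 2 :=
      integral_nonneg fun _ ↦ by positivity
    have hsq : screwNormZeroR ψ ^ 2 = (∫ x : ℝ, ‖screwPhatR (suzukiD ψ) x‖ ^ 2) / Real.pi := by
      unfold screwNormZeroR
      rw [Real.sq_sqrt (div_nonneg hA Real.pi_pos.le)]
    rw [hsq, Complex.ofReal_div, div_eq_iff hπ, mul_comm]
  exact (show Suzuki2025_thm14R from Suzuki2025_thm14R_holds).trans
    (forall_congr' fun ψ ↦ imp_congr_right fun _ ↦ (key ψ).symm)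

end Literature.NumberTheory.LFunctions

end
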